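import Summits.ResolutionOfSingularities.ResolutionOfSingularities.Theorems.PurelyInseparableDim4ScopeBlindAlgebraic
import Mathlib.RingTheory.MvPolynomial.Ideal
import HarnessLib

/-!
# BLINDNESS certificates with a MONOMIAL-SUPPORT witness (point-free): `blindSB`, `rblindSB`, `algBlindSB`
# (cell `res-dim4-pi`; scope column of the F4-C instrument ‖ K; seat res-dim4-p-13 (g2))

[OURS · counted 0 · instrument] Nothing here is a statement about resolution of singularities; resolution in
dimension `≥ 4` / characteristic `p > 0` is NOT proved by anything in this file.

The landed checkers `ScopeBlind.blindB` (monomial curves), `rblindB` (rational curves) and `algBlindB` (algebraic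
plane branches) certify `¬ InCoordinateScope q F` through res-dim4-p-3's kernel form
`IsolationCert.not_inCoordinateScope_of_ringHom`, whose last clause «`J_q⁺(F) ⊄ (x_V)`» is witnessed by a POINT
`a ∈ K⁴` with `a|_V = 0` and `D^{(α₀)}F(a) ≠ 0`.  Over `K = 𝔽₂` such a point need not exist although the clause
holds: e.g. the band root S1a-132048ee5b `x₂x₃x₄² + x₂x₃²x₄ + x₂²x₃x₄` is blind along the plane `x₂ = x₄, x₃ = 0`
(`V = {x₁, x₃}`), but `∂₃F|_{V(x₁,x₃)} = x₂x₄(x₂ + x₄)` kills every `𝔽₂`-point.  Since `(x_V)` is a MONOMIAL ideal,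
the clause is equivalent to: some Hasse derivative `D^{(α₀)}F`, `0 < |α₀| < q`, has a monomial supported OFF `V`
(`MvPolynomial.mem_ideal_span_X_image`) — a point-free, `decide`-able witness.  This file:

* §1 `not_le_span_X_image_of_support`, `not_inCoordinateScope_of_ringHom'` (the kernel form with the support
  witness);
* §2 the three checkers with the support witness — **`blindSB q s c w α₀ m`**, **`rblindSB q s P v D k α₀ m`**,
  **`algBlindSB q s cs D g h Q V α₀ m`** — and their soundness theorems (`not_inCoordinateScope_of_blindSB` /
  `…_of_rblindSB` / `…_of_algBlindSB`), proofs verbatim those of the point versions up to the last clause;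
* §3 acceptance (`decide`, `q = 2`, `𝔽₂`): S1a-132048ee5b by `blindSB` (curve `x₂ = x₄ = t`); S1a-0a1fe38c53
  `x₂x₃x₄² + x₁x₂x₃x₄ + x₁²x₂x₃` by `algBlindSB` along the branch `x₁, x₃ ↦ t`, `x₄ ↦ y`, `x₂ ↦ 0` on
  `y² + ty + t² = 0` (conjugate planes `x₄ = ωx₁` over `𝔽₄`, one irreducible conic over `𝔽₂`).

Blindness over `𝔽₂` is blindness over every field of characteristic `2` (`ScopeDescent.not_inCoordinateScope_map_iff`).
OURS; counted 0; AI kernel work, weaker than expert review.  bears_on: LADDER-RESOLUTION:D157-DOOR2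
(res-dim4-pi · F4-C instrument ‖ K · scope column).  Supports stmt-ResolutionOfSingularities-16155 (helper).
-/

set_option linter.dupNamespace false -- mandated namespace of this single-conjunct summit

noncomputable section

open MvPolynomial Finset
open scoped BigOperators

namespace Summit.ResolutionOfSingularities.ResolutionOfSingularities.Theorems.PIDim4

namespace ScopeBlind

open StepKit ScopeCover
open Literature.AlgebraicGeometry.Resolution

variable {K : Type} [Field K]

/-! ## §1 The point-free escaping generator -/

/-- **`J_q⁺(F) ⊄ (x_V)` from one monomial**: a Hasse derivative `D^{(α)}F` (`0 < |α| < q`) with a monomial `m`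
in its support involving no variable of `V` is not in the monomial ideal `(x_V)`. [folklore] -/
theorem not_le_span_X_image_of_support {q : ℕ} {F : MvPolynomial (Fin 4) K} (V : Finset (Fin 4))
    (α : Fin 4 →₀ ℕ) (h0 : 0 < α.degree) (hq : α.degree < q) (m : Fin 4 →₀ ℕ)
    (hm : m ∈ (hasseDeriv α F).support) (hV : ∀ i ∈ V, m i = 0) :
    ¬ singLocusIdeal q F ≤
      Ideal.span ((fun i => (X i : MvPolynomial (Fin 4) K)) '' (V : Set (Fin 4))) := by
  intro hle
  have hmem : hasseDeriv α F ∈ Ideal.span (MvPolynomial.X '' (V : Set (Fin 4)) : Set (MvPolynomial (Fin 4) K)) :=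
    hle (Ideal.subset_span ⟨α, h0, hq, rfl⟩)
  obtain ⟨i, hi, hne⟩ := MvPolynomial.mem_ideal_span_X_image.mp hmem m hm
  exact hne (hV i hi)

/-- **Kernel form of the blindness certificate, point-free witness**: as
`IsolationCert.not_inCoordinateScope_of_ringHom`, the last clause replaced by a monomial of `D^{(α)}F` supported
off `V`. [folklore] -/
theorem not_inCoordinateScope_of_ringHom' {q : ℕ} {F : MvPolynomial (Fin 4) K}
    {B : Type*} [CommRing B] [IsDomain B] (φ : MvPolynomial (Fin 4) K →+* B)
    (hJ : ∀ α : Fin 4 →₀ ℕ, 0 < α.degree → α.degree < q → φ (hasseDeriv α F) = 0)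
    (h0 : ∀ g : MvPolynomial (Fin 4) K, φ g = 0 → MvPolynomial.eval (0 : Fin 4 → K) g = 0)
    (V : Finset (Fin 4)) (hV : ∀ i : Fin 4, i ∉ V → φ (X i) ≠ 0)
    (α : Fin 4 →₀ ℕ) (hα0 : 0 < α.degree) (hαq : α.degree < q) (m : Fin 4 →₀ ℕ)
    (hm : m ∈ (hasseDeriv α F).support) (hmV : ∀ i ∈ V, m i = 0) :
    ¬ InCoordinateScope q F := by
  refine IsolationCert.not_inCoordinateScope_of_prime (P := RingHom.ker φ) (RingHom.ker_isPrime φ) ?_ ?_ V ?_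
    (not_le_span_X_image_of_support V α hα0 hαq m hm hmV)
  · unfold singLocusIdeal
    rw [Ideal.span_le]
    rintro _ ⟨β, hβ0, hβq, rfl⟩
    exact (RingHom.mem_ker).mpr (hJ β hβ0 hβq)
  · intro g hg
    unfold originIdeal
    exact (RingHom.mem_ker).mpr (h0 g ((RingHom.mem_ker).mp hg))
  · intro i hi
    by_contra hiV
    exact hV i hiV ((RingHom.mem_ker).mp hi)

/-- The support clause on term lists: `coeffAt (hasseL α₀ L) m ≠ 0` puts `expo m` in the support of
`D^{(α₀)}(evalT L)`. [folklore] -/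
theorem expo_mem_support_hasseDeriv {α₀ m : Fin 4 → ℕ} {L : Terms 4 K}
    (h : coeffAt (hasseL α₀ L) m ≠ 0) : expo m ∈ (hasseDeriv (expo α₀) (evalT L)).support := by
  rw [hasseDeriv_evalT, MvPolynomial.mem_support_iff, coeff_expo_evalT]
  exact h

variable [DecidableEq K]

/-! ## §2 The three checkers with the support witness -/

/-- **Monomial-curve blindness check, support witness**: as `blindB`, the last clauses being «`m` involves no
variable with `cᵢ = 0`» and «`coeff_m D^{(α₀)}F ≠ 0`». [folklore] -/
def blindSB (q : ℕ) (s : SData 4 K) (c : Fin 4 → K) (w : Fin 4 → ℕ) (α₀ m : Fin 4 → ℕ) : Bool :=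
  decide (∀ i, c i = 0 ∨ 1 ≤ w i) &&
    ((idxLT q).all fun α => StepKit.equivB (curveL c w (hasseL α s.L)) []) &&
    decide (∀ i, c i = 0 → m i = 0) &&
    decide (0 < ∑ i, α₀ i ∧ ∑ i, α₀ i < q) &&
    !decide (coeffAt (hasseL α₀ s.L) m = 0)

/-- **Soundness of `blindSB`.** [folklore] -/
theorem not_inCoordinateScope_of_blindSB {q : ℕ} {s : SData 4 K} {c : Fin 4 → K} {w : Fin 4 → ℕ}
    {α₀ m : Fin 4 → ℕ} (h : blindSB q s c w α₀ m = true) : ¬ InCoordinateScope q s.toState.F := by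
  simp only [blindSB, Bool.and_eq_true, decide_eq_true_eq, List.all_eq_true, Bool.not_eq_true',
    decide_eq_false_iff_not] at h
  obtain ⟨⟨⟨⟨hw, hJ⟩, hm⟩, hα₀⟩, hne⟩ := h
  have hdeg : (expo α₀).degree = ∑ i, α₀ i := degree_expo α₀
  refine not_inCoordinateScope_of_ringHom' (curveHom c w).toRingHom (fun α h0 hq => ?_)
    (eval_zero_of_curveHom_eq_zero hw) (Finset.univ.filter fun i => c i = 0) (fun i hi => ?_)
    (expo α₀) (by rw [hdeg]; exact hα₀.1) (by rw [hdeg]; exact hα₀.2) (expo m) ?_ (fun i hi => ?_)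
  · change curveHom c w (hasseDeriv α s.toState.F) = 0
    rw [SData.toState_F, ← expo_coe α, hasseDeriv_evalT, aeval_curve_evalT, evalT_eq_zero_iff]
    exact hJ (⇑α) (mem_idxLT h0 hq)
  · change curveHom c w (X i) ≠ 0
    have hci : c i ≠ 0 := by simpa using hi
    rw [curveHom, MvPolynomial.aeval_X]
    exact (monomial_eq_zero).not.mpr hci
  · rw [SData.toState_F]
    exact expo_mem_support_hasseDeriv hne
  · exact hm i (by simpa using hi)

/-- **Rational-curve blindness check, support witness**: as `rblindB`, last clauses «`m` involves no variable of
`V = {i : coeff_{t^{kᵢ}} Pᵢ = 0}`» and «`coeff_m D^{(α₀)}F ≠ 0`». [folklore] -/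
def rblindSB (q : ℕ) (s : SData 4 K) (P : Fin 4 → Terms 1 K) (v : Fin 4 → ℕ) (D : Terms 1 K) (k : Fin 4 → ℕ)
    (α₀ m : Fin 4 → ℕ) : Bool :=
  decide (∀ i, coeffAt (P i) (fun _ => 0) = 0) &&
    !decide (coeffAt D (fun _ => 0) = 0) &&
    ((idxLT q).all fun α => StepKit.equivB (rcurveLN P v D (maxV v (hasseL α s.L)) (hasseL α s.L)) []) &&
    decide (∀ i, coeffAt (P i) (fun _ => k i) = 0 → m i = 0) &&
    decide (0 < ∑ i, α₀ i ∧ ∑ i, α₀ i < q) &&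
    !decide (coeffAt (hasseL α₀ s.L) m = 0)

/-- **Soundness of `rblindSB`.** [folklore] -/
theorem not_inCoordinateScope_of_rblindSB {q : ℕ} {s : SData 4 K} {P : Fin 4 → Terms 1 K} {v : Fin 4 → ℕ}
    {D : Terms 1 K} {k α₀ m : Fin 4 → ℕ} (h : rblindSB q s P v D k α₀ m = true) :
    ¬ InCoordinateScope q s.toState.F := by
  simp only [rblindSB, Bool.and_eq_true, decide_eq_true_eq, List.all_eq_true, Bool.not_eq_true',
    decide_eq_false_iff_not] at h
  obtain ⟨⟨⟨⟨⟨hP, hD⟩, hJ⟩, hm⟩, hα₀⟩, hne⟩ := h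
  have hD' : PowerSeries.constantCoeff (ps D) ≠ 0 := by
    rwa [← PowerSeries.coeff_zero_eq_constantCoeff_apply, ps, coeff_psi_evalT]
  have hdeg : (expo α₀).degree = ∑ i, α₀ i := degree_expo α₀
  refine not_inCoordinateScope_of_ringHom' (rcurveHom P v D).toRingHom (fun α h0 hq => ?_)
    (fun g hg => ?_) (Finset.univ.filter fun i => coeffAt (P i) (fun _ => k i) = 0) (fun i hi => ?_)
    (expo α₀) (by rw [hdeg]; exact hα₀.1) (by rw [hdeg]; exact hα₀.2) (expo m) ?_ (fun i hi => ?_)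
  · change rcurveHom P v D (hasseDeriv α s.toState.F) = 0
    rw [SData.toState_F, ← expo_coe α, hasseDeriv_evalT]
    apply rcurveHom_evalT_eq_zero P v D hD'
    rw [evalT_eq_zero_iff]
    exact hJ (⇑α) (mem_idxLT h0 hq)
  · rw [← IsolationCert.constantCoeff_aeval_curve _ (rcurve_constantCoeff P v D hP) g]
    change PowerSeries.constantCoeff (rcurveHom P v D g) = 0
    rw [show rcurveHom P v D g = 0 from hg, map_zero]
  · change rcurveHom P v D (X i) ≠ 0
    have hki : coeffAt (P i) (fun _ => k i) ≠ 0 := by simpa using hi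
    rw [rcurveHom, MvPolynomial.aeval_X]
    have hPi : ps (P i) ≠ 0 := by
      intro h0; apply hki; rw [← coeff_psi_evalT, ← ps, h0, map_zero]
    have hinv : ((ps D)⁻¹ : PowerSeries K) ≠ 0 := by
      intro h0
      have := PowerSeries.mul_inv_cancel (ps D) hD'
      rw [h0, mul_zero] at this
      exact zero_ne_one this
    exact mul_ne_zero hPi (pow_ne_zero _ hinv)
  · rw [SData.toState_F]
    exact expo_mem_support_hasseDeriv hne
  · exact hm i (by simpa using hi)

/-- **Algebraic-branch blindness check, support witness**: as `algBlindB`, last clauses «`m` involves no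
variable of `V`» and «`coeff_m D^{(α₀)}F ≠ 0`». [folklore] -/
def algBlindSB (q : ℕ) (s : SData 4 K) (cs : List K) (D : ℕ) (g : Terms 2 K) (h : Fin 4 → Terms 2 K)
    (Q : List (Terms 2 K)) (V : Finset (Fin 4)) (α₀ m : Fin 4 → ℕ) : Bool :=
  irredB cs D g && ((live g).any fun e => decide (∑ i, e i = D)) &&
    decide (coeffAt g (fun _ => 0) = 0) &&
    decide (∀ i, coeffAt (h i) (fun _ => 0) = 0) &&
    decide (∀ i, i ∉ V → tdegL (h i) < D ∧ StepKit.equivB (h i) [] = false) &&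
    decide ((idxLT q).length = Q.length) &&
    ((List.zip (idxLT q) Q).all fun αQ => StepKit.equivB (substL h (hasseL αQ.1 s.L)) (mulN αQ.2 g)) &&
    decide (∀ i ∈ V, m i = 0) &&
    decide (0 < ∑ i, α₀ i ∧ ∑ i, α₀ i < q) &&
    !decide (coeffAt (hasseL α₀ s.L) m = 0)

/-- **Soundness of `algBlindSB`** (as `not_inCoordinateScope_of_algBlindB`, point-free witness). [folklore] -/
theorem not_inCoordinateScope_of_algBlindSB {q : ℕ} {s : SData 4 K} {cs : List K} (hcs : ∀ c : K, c ∈ cs)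
    {D : ℕ} {g : Terms 2 K} {h : Fin 4 → Terms 2 K} {Q : List (Terms 2 K)} {V : Finset (Fin 4)}
    {α₀ m : Fin 4 → ℕ} (hc : algBlindSB q s cs D g h Q V α₀ m = true) :
    ¬ InCoordinateScope q s.toState.F := by
  simp only [algBlindSB, Bool.and_eq_true, decide_eq_true_eq, List.all_eq_true, List.any_eq_true,
    Bool.not_eq_true', decide_eq_false_iff_not] at hc
  obtain ⟨⟨⟨⟨⟨⟨⟨⟨⟨hirr, hdegD⟩, hg0⟩, hh0⟩, hV⟩, hlen⟩, hJ⟩, hmV⟩, hα₀⟩, hne⟩ := hc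
  set G : MvPolynomial (Fin 2) K := evalT g with hGdef
  set H : Fin 4 → MvPolynomial (Fin 2) K := fun i => evalT (h i) with hHdef
  have hGirr : Irreducible G := irreducible_of_irredB hcs hirr
  have hG0 : G ≠ 0 := hGirr.ne_zero
  have hGdeg : D ≤ G.totalDegree := by
    obtain ⟨e, he, hsum⟩ := hdegD
    have hsupp : expo e ∈ G.support := (expo_mem_support_iff g e).mpr he
    have := MvPolynomial.le_totalDegree hsupp
    rw [Finsupp.sum_fintype _ _ (fun _ => rfl)] at this
    simp only [expo_apply] at this
    rwa [hsum] at this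
  let I : Ideal (MvPolynomial (Fin 2) K) := Ideal.span {G}
  haveI hIprime : I.IsPrime :=
    (Ideal.span_singleton_prime hG0).mpr (UniqueFactorizationMonoid.irreducible_iff_prime.mp hGirr)
  let φ : MvPolynomial (Fin 4) K →+* MvPolynomial (Fin 2) K ⧸ I :=
    (Ideal.Quotient.mk I).comp (MvPolynomial.aeval H : MvPolynomial (Fin 4) K →ₐ[K] MvPolynomial (Fin 2) K).toRingHom
  haveI : IsDomain (MvPolynomial (Fin 2) K ⧸ I) := Ideal.Quotient.isDomain I
  have hφ : ∀ R : MvPolynomial (Fin 4) K, φ R = 0 ↔ MvPolynomial.aeval H R ∈ I := fun R => by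
    change Ideal.Quotient.mk I (MvPolynomial.aeval H R) = 0 ↔ _
    exact Ideal.Quotient.eq_zero_iff_mem
  have hdeg : (expo α₀).degree = ∑ i, α₀ i := degree_expo α₀
  refine not_inCoordinateScope_of_ringHom' φ (fun α h0 hq => ?_) (fun R hR => ?_) V
    (fun i hi => ?_) (expo α₀) (by rw [hdeg]; exact hα₀.1) (by rw [hdeg]; exact hα₀.2) (expo m) ?_ hmV
  · rw [hφ]
    have hmem : (⇑α) ∈ idxLT q := mem_idxLT h0 hq
    obtain ⟨k, hk, hkα⟩ := List.getElem_of_mem hmem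
    have hkQ : k < Q.length := by rw [← hlen]; exact hk
    have hpair : ((idxLT q)[k], Q[k]) ∈ List.zip (idxLT q) Q := by
      rw [List.mem_iff_getElem]
      exact ⟨k, by rw [List.length_zip]; exact lt_min hk hkQ, by rw [List.getElem_zip]⟩
    have heq := hJ _ hpair
    rw [hkα] at heq
    dsimp only at heq
    rw [← evalT_eq_iff_equivB, evalT_substL, evalT_mulN] at heq
    rw [SData.toState_F, ← expo_coe α, hasseDeriv_evalT]
    change MvPolynomial.aeval H (evalT (hasseL (⇑α) s.L)) ∈ Ideal.span {G}
    rw [heq]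
    exact Ideal.mem_span_singleton'.mpr ⟨evalT Q[k], rfl⟩
  · rw [hφ] at hR
    obtain ⟨c, hcG⟩ := Ideal.mem_span_singleton'.mp hR
    have hH0 : (fun i => MvPolynomial.eval₂Hom (RingHom.id K) (0 : Fin 2 → K) (H i)) = (0 : Fin 4 → K) := by
      funext i
      change MvPolynomial.eval (0 : Fin 2 → K) (evalT (h i)) = 0
      rw [eval_zero_evalT2]; exact hh0 i
    have hev : MvPolynomial.eval (0 : Fin 2 → K) (MvPolynomial.aeval H R) =
        MvPolynomial.eval (0 : Fin 4 → K) R := by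
      have key := MvPolynomial.eval₂Hom_bind₁ (RingHom.id K) (0 : Fin 2 → K) H R
      rw [hH0] at key
      exact key
    rw [← hev, ← hcG, map_mul]
    change _ * MvPolynomial.eval (0 : Fin 2 → K) (evalT g) = 0
    rw [eval_zero_evalT2 g, hg0, mul_zero]
  · obtain ⟨hlt, hnz⟩ := hV i hi
    rw [Ne, hφ, MvPolynomial.aeval_X]
    intro hmem
    have hHi0 : H i ≠ 0 := by
      intro h0
      have : StepKit.equivB (h i) [] = true := (evalT_eq_zero_iff (h i)).mp h0
      rw [hnz] at this; exact Bool.false_ne_true this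
    have hdvd : G ∣ H i := Ideal.mem_span_singleton.mp hmem
    have := totalDegree_le_of_dvd_of_isDomain hdvd hHi0
    rw [show (H i).totalDegree = tdegL (h i) from totalDegree_evalT (h i)] at this
    omega
  · rw [SData.toState_F]
    exact expo_mem_support_hasseDeriv hne

/-- Batch rows for `algBlindSB` (leaf supply): state, `D`, `g`, `h`, `Q`, `V`, `α₀`, `m`. [folklore] -/
abbrev AlgSRow (K : Type) : Type :=
  SData 4 K × ℕ × Terms 2 K × (Fin 4 → Terms 2 K) × List (Terms 2 K) × Finset (Fin 4) × (Fin 4 → ℕ) × (Fin 4 → ℕ)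

/-- Running the certificate of a row. [folklore] -/
def rowAlgSB (q : ℕ) (cs : List K) (r : AlgSRow K) : Bool :=
  algBlindSB q r.1 cs r.2.1 r.2.2.1 r.2.2.2.1 r.2.2.2.2.1 r.2.2.2.2.2.1 r.2.2.2.2.2.2.1 r.2.2.2.2.2.2.2

/-- **Batch form**: every state of a list of passing rows is BLIND. [folklore] -/
theorem not_inCoordinateScope_of_all_rowAlgSB {q : ℕ} {cs : List K} (hcs : ∀ c : K, c ∈ cs)
    {rows : List (AlgSRow K)} (h : rows.all (rowAlgSB q cs) = true) :
    ∀ r ∈ rows, ¬ InCoordinateScope q r.1.toState.F :=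
  fun r hr => not_inCoordinateScope_of_algBlindSB hcs (List.all_eq_true.mp h r hr)

/-! ## §3 Acceptance (`decide`, `q = 2`, `𝔽₂`) -/

/-- Band root S1a-132048ee5b `x₂x₃x₄² + x₂x₃²x₄ + x₂²x₃x₄ = x₂x₃x₄(x₂ + x₃ + x₄)`. [folklore] -/
def specPlane : SData 4 (ZMod 2) := ⟨[(![0, 1, 1, 2], 1), (![0, 1, 2, 1], 1), (![0, 2, 1, 1], 1)], ![0, 0, 0, 0], ∅⟩

/-- `specPlane` is BLIND along `x₂ = x₄ = t` (`x₁ = x₃ = 0`): the partials vanish there, and `∂₃F` carries the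
monomial `x₂x₄²` supported off `V = {x₁, x₃}` — although `∂₃F` kills every `𝔽₂`-point of `V(x₁, x₃)`. -/
theorem blindSB_specPlane : blindSB 2 specPlane ![0, 1, 0, 1] ![0, 1, 0, 1] ![0, 0, 1, 0] ![0, 1, 0, 2] = true := by
  decide

/-- **`specPlane` is BLIND.** [folklore] -/
theorem not_inCoordinateScope_specPlane : ¬ InCoordinateScope 2 specPlane.toState.F :=
  not_inCoordinateScope_of_blindSB blindSB_specPlane

/-- Band root S1a-0a1fe38c53 `x₂x₃x₄² + x₁x₂x₃x₄ + x₁²x₂x₃ = x₂x₃(x₄² + x₁x₄ + x₁²)`. [folklore] -/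
def specConic : SData 4 (ZMod 2) := ⟨[(![0, 1, 1, 2], 1), (![1, 1, 1, 1], 1), (![2, 1, 1, 0], 1)], ![0, 0, 0, 0], ∅⟩

/-- `specConic` is BLIND along the algebraic branch `x₁ ↦ t, x₃ ↦ t, x₄ ↦ y, x₂ ↦ 0` on the irreducible conic
`y² + ty + t² = 0` (conjugate planes `x₄ = ωx₁` over `𝔽₄`): `∂₂F ↦ t·g`, the other partials `↦ 0`; witness the
monomial `x₃x₄²` of `∂₂F`, supported off `V = {x₂}`. -/
theorem algBlindSB_specConic :
    algBlindSB 2 specConic [0, 1] 2 [(![0, 2], 1), (![1, 1], 1), (![2, 0], 1)]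
      ![[(![1, 0], 1)], [], [(![1, 0], 1)], [(![0, 1], 1)]] [[], [], [(![1, 0], 1)], []] {1}
      ![0, 1, 0, 0] ![0, 0, 1, 2] = true := by
  decide

/-- **`specConic` is BLIND.** [folklore] -/
theorem not_inCoordinateScope_specConic : ¬ InCoordinateScope 2 specConic.toState.F :=
  not_inCoordinateScope_of_algBlindSB (cs := [0, 1]) mem_coeffs_zmod2 algBlindSB_specConic

end ScopeBlind

end Summit.ResolutionOfSingularities.ResolutionOfSingularities.Theorems.PIDim4
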